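import Summits.QuantumFields.GaugeBoot.Certificates.SparseReducedWindow
import Summits.QuantumFields.GaugeBoot.Certificates.KZL2rpD4b11o5W22UpDA
import Summits.QuantumFields.GaugeBoot.Certificates.KZL2rpD4b11o5W22UpDB
import HarnessLib

/-!
# Kernel replay of the certsdp certificate `kzL2rp_D4_b11o5_W2x2_upper` — part G: factor-row assembly and objective (gb_lean_emit_win 0.10.1)

Cell `ym-instrument` (HUMAN RULING D-0084 (2)), seat `ym-instrument-boot-lean-1`: crew (a) certificate row `SU2-D4-b11o5-kzL2rp-w2x2-upper`
(`pub/ym-instrument/certs/a/files/SU2-D4/kzL2rp/`, Q-A1 R-A1.0 STEP-0, REF-3 CERT-PASS 2026-08-26T18:27:53Z), emitted with the INHERITED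
`pub-gaugeboot` emitter `gb_lean_emit_win 0.10.1` (kit job j259729; family tables `KZL2rpD4*` of record, family signature 981d7f3d61508310).
HONEST FRAMING (cells `pub-gaugeboot` / `ym-instrument`): certified bounds on lattice expectations at stated coupling,
gauge group, dimension and torus size; NOT a mass gap, NOT a continuum limit, NOT a string tension;
NOT Yang–Mills-summit-bearing (barriers `FixedCouplingUltralocality`, `PerturbativeInvisibility`).

Certificate sha256 `a6b00300f36f1bf5617e59647194bf383a2c2578b9bb70b3792018531ddd6334` (problem `kzL2_D4_b11o5_max_rp_G2-W2x2-upper`, sha256 `5ac71dbd0843d3c225b98829f2f561ac38583166b4868e2325d4e1125eee952f`): `GB` = all factor rows (data parts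
`Certificates/KZL2rpD4b11o5W22UpD….lean` concatenated), the INTEGER objective row `cZ`, the certified bound `lowerQ`, and the kernel check
`gb_len` (factor rows fit the padded dimension 48). Windows: `Certificates/KZL2rpD4b11o5W22UpA….lean`; assembly + theorems: `Certificates/KZL2rpD4b11o5W22Up.lean`.
Data/plumbing only; nothing is claimed about lattice gauge theory in this file.
-/

namespace Summit.QuantumFields.GaugeBoot.Certificates.KZL2rpD4b11o5W22Up

noncomputable section

open Summit.QuantumFields.GaugeBoot.Certificates.Sparse

/-- All factor rows (concatenation of the data parts' block lists). -/
def GB : List (List (List ℤ)) := GBa ++ GBb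

/-- Objective as a sparse INTEGER row: (-1)·y_13. -/
def cZ : List (ℕ × ℤ) := [(13, Int.negSucc 0)]

/-- The certified lower bound on the objective (exact): `-120054452175131181550168001270299/165936402421666741376935526400000` (≈ -0.7234967760122). -/
def lowerQ : ℚ := -120054452175131181550168001270299/165936402421666741376935526400000

set_option maxHeartbeats 0 in
/-- Kernel check: every factor row of every block has length `≤ 48`. -/
theorem gb_len : lenCheckAll KZL2rpD4b11o5W22Up.GB 48 70 = true := by
  decide +kernel

end

end Summit.QuantumFields.GaugeBoot.Certificates.KZL2rpD4b11o5W22Up
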